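import Literature.Dynamics.Tilings.OllingerSupertiles
import Literature.Dynamics.SymbolicDynamics.StrongIrreducibility
import HarnessLib

/-!
# The Ollinger subshift: a non-empty `ℤ²`-subshift of finite type

The set `ollingerShift` of tilings of the plane by Ollinger's 104 tiles
(`Literature/Dynamics/Tilings/OllingerTiles.lean`; configurations `x : ℤ × ℤ → GoodTile`,
cell `(i, j)` = column `i`, row `j`, adjacent cells matching) and the first two facts of
Ollinger §3 (proof of Thm. 1) about it:

* `isSFT_ollingerShift` — it is a subshift of finite type (window `{(0,0), (1,0), (0,1)}`), in
  the vocabulary `IsSFT` of `Literature/Dynamics/SymbolicDynamics/StrongIrreducibility.lean`;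
* `ollingerShift_nonempty` — "The tile set `τ` admits at least one tiling": the explicit
  configuration `conf` assembled from the nested supertiles of the four seed tiles of
  `OllingerSupertiles.lean` (one quadrant each; inside a quadrant adjacent cells match by
  `hmatch_cellS`, across the axes by `hmatch_cellS_boundary` since the seed is a valid pattern);
The decomposition of tilings into images of tilings ("`τ` codes `s`") and the aperiodicity
(Ollinger's Thm. 1) are in `OllingerAperiodic.lean`.

## References

* N. Ollinger, *Two-by-Two Substitution Systems and the Undecidability of the Domino Problem*,
  CiE 2008, LNCS 5028, doi:10.1007/978-3-540-69407-6_51, Props. 3–4, §3 Thm. 1.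
* E. Jeandel, P. Vanier, *The Undecidability of the Domino Problem*, LNM 2273 (2020), §3.2
  Prop. 8 (the same argument).
-/

namespace Literature.Dynamics.Tilings.Ollinger

open Tile
open Literature.Dynamics.SymbolicDynamics (IsSFT IsAperiodic)
open _root_.SymbolicDynamics.FullShift

/-! ### Tilings and the subshift -/

/-- `x : ℤ² → GoodTile` is a **tiling**: horizontally and vertically adjacent cells match
(cell `(i, j)`: column `i` to the east, row `j` to the north). [cite: Ollinger2008, §2] -/
def IsOTiling (x : ℤ × ℤ → GoodTile) : Prop :=
  ∀ i j : ℤ, hmatch (x (i, j)).1 (x (i + 1, j)).1 = true ∧ vmatch (x (i, j)).1 (x (i, j + 1)).1 = true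

/-- **The Ollinger subshift**: the set of tilings by the 104 tiles ("The set of tilings `X_τ` of a
tile set `τ` is a subshift (of finite type)"). [cite: Ollinger2008, §2] -/
def ollingerShift : Set (ℤ × ℤ → GoodTile) :=
  {x | IsOTiling x}

/-- [cite: Ollinger2008, §2] -/
@[simp] theorem mem_ollingerShift {x : ℤ × ℤ → GoodTile} : x ∈ ollingerShift ↔ IsOTiling x :=
  Iff.rfl

/-- **The Ollinger subshift is of finite type** (window `{(0,0), (1,0), (0,1)}`, allowed patterns
= matching pairs). [cite: Ollinger2008, §2] -/
theorem isSFT_ollingerShift : IsSFT ollingerShift := by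
  classical
  let Ω : Finset (ℤ × ℤ) := {((0 : ℤ), (0 : ℤ)), ((1 : ℤ), (0 : ℤ)), ((0 : ℤ), (1 : ℤ))}
  have h00 : ((0 : ℤ), (0 : ℤ)) ∈ Ω := by simp [Ω]
  have h10 : ((1 : ℤ), (0 : ℤ)) ∈ Ω := by simp [Ω]
  have h01 : ((0 : ℤ), (1 : ℤ)) ∈ Ω := by simp [Ω]
  refine ⟨Ω, {q | hmatch (q ⟨_, h00⟩).1 (q ⟨_, h10⟩).1 = true ∧
    vmatch (q ⟨_, h00⟩).1 (q ⟨_, h01⟩).1 = true}, ?_⟩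
  ext x
  simp only [mem_ollingerShift, IsOTiling, Set.mem_setOf_eq, shift_apply]
  constructor
  · intro h v
    obtain ⟨i, j⟩ := v
    simpa using h i j
  · intro h i j
    simpa using h (i, j)

/-! ### An explicit tiling: the subshift is non-empty -/

/-- South-west quadrant: the cell at offset `(i, j)` (to the west, to the south) from the corner
cell of the nested supertiles of `seedA = x*`, computed at order `m`.
[cite: Ollinger2008, §3 (proof of Thm. 1)] -/
def quadA (m i j : ℕ) : Tile := cellS m seedA (2 ^ m - 1 - i) (2 ^ m - 1 - j)

/-- South-east quadrant (`i` to the east, `j` to the south), from `seedB`. [cite: Ollinger2008, §3 (proof of Thm. 1)] -/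
def quadB (m i j : ℕ) : Tile := cellS m seedB i (2 ^ m - 1 - j)

/-- North-west quadrant (`i` to the west, `j` to the north), from `seedC`. [cite: Ollinger2008, §3 (proof of Thm. 1)] -/
def quadC (m i j : ℕ) : Tile := cellS m seedC (2 ^ m - 1 - i) j

/-- North-east quadrant, from `seedD`. [cite: Ollinger2008, §3 (proof of Thm. 1)] -/
def quadD (m i j : ℕ) : Tile := cellS m seedD i j

/-- The quadrants do not depend on the order at which they are computed (nested supertiles).
[cite: Ollinger2008, §3 (proof of Thm. 1)] -/
theorem quad_stable {i j m : ℕ} (hi : i < 2 ^ m) (hj : j < 2 ^ m) (k : ℕ) :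
    quadA (m + k) i j = quadA m i j ∧ quadB (m + k) i j = quadB m i j ∧
      quadC (m + k) i j = quadC m i j ∧ quadD (m + k) i j = quadD m i j := by
  induction k with
  | zero => exact ⟨rfl, rfl, rfl, rfl⟩
  | succ k ih =>
    have hpow : 2 ^ m ≤ 2 ^ (m + k) := Nat.pow_le_pow_right (by norm_num) (by omega)
    have hi' : i < 2 ^ (m + k) := lt_of_lt_of_le hi hpow
    have hj' : j < 2 ^ (m + k) := lt_of_lt_of_le hj hpow
    have h2 : (2 : ℕ) ^ (m + k + 1) = 2 * 2 ^ (m + k) := by ring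
    obtain ⟨hA, hB, hC, hD⟩ := ih
    rw [← add_assoc]
    refine ⟨?_, ?_, ?_, ?_⟩
    · rw [← hA]
      unfold quadA
      have := cellS_stable subst_seed.1 (m + k) (i := 2 ^ (m + k) - 1 - i)
        (j := 2 ^ (m + k) - 1 - j) (by omega) (by omega)
      simp only [qoff_true] at this
      rw [← this]
      congr 1 <;> omega
    · rw [← hB]
      unfold quadB
      have := cellS_stable subst_seed.2.1 (m + k) (i := i) (j := 2 ^ (m + k) - 1 - j) hi'
        (by omega)
      simp only [qoff_true, qoff_false, zero_add] at this
      rw [← this]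
      congr 1
      omega
    · rw [← hC]
      unfold quadC
      have := cellS_stable subst_seed.2.2.1 (m + k) (i := 2 ^ (m + k) - 1 - i) (j := j)
        (by omega) hj'
      simp only [qoff_true, qoff_false, zero_add] at this
      rw [← this]
      congr 1
      omega
    · rw [← hD]
      unfold quadD
      have := cellS_stable subst_seed.2.2.2 (m + k) (i := i) (j := j) hi' hj'
      simpa using this

/-- Offset of a coordinate from the axes: `i ↦ i` for `i ≥ 0` and `i ↦ -i-1` for `i < 0`. [folklore] -/
def offE (i : ℤ) : ℕ := if 0 ≤ i then i.toNat else (-i - 1).toNat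

/-- [folklore] -/
theorem offE_of_nonneg {i : ℤ} (h : 0 ≤ i) : (offE i : ℤ) = i := by
  unfold offE; rw [if_pos h]; omega

/-- [folklore] -/
theorem offE_of_neg {i : ℤ} (h : i < 0) : (offE i : ℤ) = -i - 1 := by
  unfold offE; rw [if_neg (not_le.mpr h)]; omega

/-- **The explicit configuration**: each quadrant of the plane is filled with the nested
supertiles of one seed tile. [cite: Ollinger2008, §3 (proof of Thm. 1)] -/
def conf (p : ℤ × ℤ) : Tile :=
  if 0 ≤ p.1 then
    if 0 ≤ p.2 then quadD (offE p.1 + offE p.2 + 1) (offE p.1) (offE p.2)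
    else quadB (offE p.1 + offE p.2 + 1) (offE p.1) (offE p.2)
  else
    if 0 ≤ p.2 then quadC (offE p.1 + offE p.2 + 1) (offE p.1) (offE p.2)
    else quadA (offE p.1 + offE p.2 + 1) (offE p.1) (offE p.2)

/-- The cells of `conf` are good tiles. [cite: Ollinger2008, §3] -/
theorem good_conf (p : ℤ × ℤ) : (conf p).good = true := by
  unfold conf quadA quadB quadC quadD
  obtain ⟨hA, hB, hC, hD⟩ := good_seed
  split_ifs <;> exact good_cellS (by assumption) _ _ _

/-- `conf` evaluated at any large enough order. [folklore] -/
theorem conf_eq (p : ℤ × ℤ) (M : ℕ) (hM : offE p.1 + offE p.2 + 1 ≤ M) :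
    conf p = if 0 ≤ p.1 then (if 0 ≤ p.2 then quadD M (offE p.1) (offE p.2)
      else quadB M (offE p.1) (offE p.2))
      else (if 0 ≤ p.2 then quadC M (offE p.1) (offE p.2) else quadA M (offE p.1) (offE p.2)) := by
  obtain ⟨k, rfl⟩ : ∃ k, M = offE p.1 + offE p.2 + 1 + k :=
    ⟨M - (offE p.1 + offE p.2 + 1), by omega⟩
  have hlt := Nat.lt_two_pow_self (n := offE p.1 + offE p.2 + 1)
  obtain ⟨hA, hB, hC, hD⟩ := quad_stable (m := offE p.1 + offE p.2 + 1) (i := offE p.1)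
    (j := offE p.2) (by omega) (by omega) k
  unfold conf
  split_ifs
  · exact hD.symm
  · exact hB.symm
  · exact hC.symm
  · exact hA.symm

/-- **`conf` is a tiling.** Inside a quadrant adjacent cells are adjacent cells of one supertile;
across an axis they are boundary cells of the supertiles of two matching seed tiles.
[cite: Ollinger2008, §3 (proof of Thm. 1: "The tile set `τ` admits at least one tiling")] -/
theorem conf_match (i j : ℤ) :
    hmatch (conf (i, j)) (conf (i + 1, j)) = true ∧ vmatch (conf (i, j)) (conf (i, j + 1)) = true := by
  obtain ⟨gA, gB, gC, gD⟩ := good_seed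
  obtain ⟨mAB, mCD, mAC, mBD⟩ := match_seed
  -- a common order `M`, with room
  obtain ⟨M, hM⟩ : ∃ M : ℕ, offE i + offE j + offE (i + 1) + offE (j + 1) + 2 ≤ M := ⟨_, le_rfl⟩
  have hbig := Nat.lt_two_pow_self (n := M)
  have hpos : 0 < 2 ^ M := Nat.two_pow_pos M
  have bi : offE i + 1 < 2 ^ M := by omega
  have bj : offE j + 1 < 2 ^ M := by omega
  have bi1 : offE (i + 1) + 1 < 2 ^ M := by omega
  have bj1 : offE (j + 1) + 1 < 2 ^ M := by omega
  have e1 := conf_eq (i, j) M (by simp only; omega)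
  have e2 := conf_eq (i + 1, j) M (by simp only; omega)
  have e3 := conf_eq (i, j + 1) M (by simp only; omega)
  simp only at e1 e2 e3
  rw [e1, e2, e3]
  constructor
  · by_cases hj : 0 ≤ j
    · simp only [if_pos hj]
      by_cases hi : 0 ≤ i
      · -- north-east quadrant
        have ho : offE (i + 1) = offE i + 1 := by
          have := offE_of_nonneg hi; have := offE_of_nonneg (show 0 ≤ i + 1 by omega); omega
        simp only [if_pos hi, if_pos (by omega : (0 : ℤ) ≤ i + 1)]
        rw [ho]
        exact hmatch_cellS gD M (i := offE i) (j := offE j) bi (by omega)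
      · by_cases hi1 : 0 ≤ i + 1
        · -- across the vertical axis, north
          have ho : offE i = 0 := by have := offE_of_neg (not_le.mp hi); omega
          have ho' : offE (i + 1) = 0 := by have := offE_of_nonneg hi1; omega
          simp only [if_neg hi, if_pos hi1]
          rw [ho, ho']
          unfold quadC quadD
          rw [Nat.sub_zero]
          exact hmatch_cellS_boundary gC gD mCD M (j := offE j) (by omega)
        · -- north-west quadrant
          have ho : offE i = offE (i + 1) + 1 := by
            have := offE_of_neg (not_le.mp hi); have := offE_of_neg (not_le.mp hi1); omega
          simp only [if_neg hi, if_neg hi1]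
          rw [ho]
          unfold quadC
          rw [show 2 ^ M - 1 - offE (i + 1) = 2 ^ M - 1 - (offE (i + 1) + 1) + 1 by omega]
          exact hmatch_cellS gC M (i := 2 ^ M - 1 - (offE (i + 1) + 1)) (j := offE j) (by omega)
            (by omega)
    · simp only [if_neg hj]
      by_cases hi : 0 ≤ i
      · -- south-east quadrant
        have ho : offE (i + 1) = offE i + 1 := by
          have := offE_of_nonneg hi; have := offE_of_nonneg (show 0 ≤ i + 1 by omega); omega
        simp only [if_pos hi, if_pos (by omega : (0 : ℤ) ≤ i + 1)]
        rw [ho]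
        exact hmatch_cellS gB M (i := offE i) (j := 2 ^ M - 1 - offE j) bi (by omega)
      · by_cases hi1 : 0 ≤ i + 1
        · -- across the vertical axis, south
          have ho : offE i = 0 := by have := offE_of_neg (not_le.mp hi); omega
          have ho' : offE (i + 1) = 0 := by have := offE_of_nonneg hi1; omega
          simp only [if_neg hi, if_pos hi1]
          rw [ho, ho']
          unfold quadA quadB
          rw [Nat.sub_zero]
          exact hmatch_cellS_boundary gA gB mAB M (j := 2 ^ M - 1 - offE j) (by omega)
        · -- south-west quadrant
          have ho : offE i = offE (i + 1) + 1 := by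
            have := offE_of_neg (not_le.mp hi); have := offE_of_neg (not_le.mp hi1); omega
          simp only [if_neg hi, if_neg hi1]
          rw [ho]
          unfold quadA
          rw [show 2 ^ M - 1 - offE (i + 1) = 2 ^ M - 1 - (offE (i + 1) + 1) + 1 by omega]
          exact hmatch_cellS gA M (i := 2 ^ M - 1 - (offE (i + 1) + 1)) (j := 2 ^ M - 1 - offE j)
            (by omega) (by omega)
  · by_cases hi : 0 ≤ i
    · simp only [if_pos hi]
      by_cases hj : 0 ≤ j
      · -- north-east quadrant
        have ho : offE (j + 1) = offE j + 1 := by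
          have := offE_of_nonneg hj; have := offE_of_nonneg (show 0 ≤ j + 1 by omega); omega
        simp only [if_pos hj, if_pos (by omega : (0 : ℤ) ≤ j + 1)]
        rw [ho]
        exact vmatch_cellS gD M (i := offE i) (j := offE j) (by omega) bj
      · by_cases hj1 : 0 ≤ j + 1
        · -- across the horizontal axis, east
          have ho : offE j = 0 := by have := offE_of_neg (not_le.mp hj); omega
          have ho' : offE (j + 1) = 0 := by have := offE_of_nonneg hj1; omega
          simp only [if_neg hj, if_pos hj1]
          rw [ho, ho']
          unfold quadB quadD
          rw [Nat.sub_zero]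
          exact vmatch_cellS_boundary gB gD mBD M (i := offE i) (by omega)
        · -- south-east quadrant
          have ho : offE j = offE (j + 1) + 1 := by
            have := offE_of_neg (not_le.mp hj); have := offE_of_neg (not_le.mp hj1); omega
          simp only [if_neg hj, if_neg hj1]
          rw [ho]
          unfold quadB
          rw [show 2 ^ M - 1 - offE (j + 1) = 2 ^ M - 1 - (offE (j + 1) + 1) + 1 by omega]
          exact vmatch_cellS gB M (i := offE i) (j := 2 ^ M - 1 - (offE (j + 1) + 1)) (by omega)
            (by omega)
    · simp only [if_neg hi]
      by_cases hj : 0 ≤ j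
      · -- north-west quadrant
        have ho : offE (j + 1) = offE j + 1 := by
          have := offE_of_nonneg hj; have := offE_of_nonneg (show 0 ≤ j + 1 by omega); omega
        simp only [if_pos hj, if_pos (by omega : (0 : ℤ) ≤ j + 1)]
        rw [ho]
        exact vmatch_cellS gC M (i := 2 ^ M - 1 - offE i) (j := offE j) (by omega) bj
      · by_cases hj1 : 0 ≤ j + 1
        · -- across the horizontal axis, west
          have ho : offE j = 0 := by have := offE_of_neg (not_le.mp hj); omega
          have ho' : offE (j + 1) = 0 := by have := offE_of_nonneg hj1; omega
          simp only [if_neg hj, if_pos hj1]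
          rw [ho, ho']
          unfold quadA quadC
          rw [Nat.sub_zero]
          exact vmatch_cellS_boundary gA gC mAC M (i := 2 ^ M - 1 - offE i) (by omega)
        · -- south-west quadrant
          have ho : offE j = offE (j + 1) + 1 := by
            have := offE_of_neg (not_le.mp hj); have := offE_of_neg (not_le.mp hj1); omega
          simp only [if_neg hj, if_neg hj1]
          rw [ho]
          unfold quadA
          rw [show 2 ^ M - 1 - offE (j + 1) = 2 ^ M - 1 - (offE (j + 1) + 1) + 1 by omega]
          exact vmatch_cellS gA M (i := 2 ^ M - 1 - offE i) (j := 2 ^ M - 1 - (offE (j + 1) + 1))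
            (by omega) (by omega)

/-- The explicit configuration, in the alphabet of good tiles. [cite: Ollinger2008, §3 (proof of Thm. 1)] -/
def confG (p : ℤ × ℤ) : GoodTile := ⟨conf p, good_conf p⟩

/-- **The explicit configuration is a tiling.** [cite: Ollinger2008, §3 (proof of Thm. 1)] -/
theorem isOTiling_confG : IsOTiling confG := fun i j => conf_match i j

/-- **"The tile set `τ` admits at least one tiling."** [cite: Ollinger2008, §3 (proof of Thm. 1)] -/
theorem ollingerShift_nonempty : ollingerShift.Nonempty :=
  ⟨confG, isOTiling_confG⟩

end Literature.Dynamics.Tilings.Ollinger
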